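import Summits.ABC.IUTFork.Charitable.Thm311D3DeriveIff
import Summits.ABC.IUTFork.Charitable.Thm311D4Derive
import Summits.ABC.IUTFork.Charitable.Thm311D4Checks
import HarnessLib

/-!
# [IUTchIII] Thm 3.11 re-typed charitably — POST-LIFT KERNEL CONCORDANCE, leg D3 ↔ D4 (`Thm311Charitable_3` vs `Thm311Charitable_4`)

PROOF-ONLY file (D-0012; no definition — the D4 data of §1 is built inside the proof —, no `Prop` fact, nothing asserted) of the abc-iut cell, BLOCK D (rung LADDER-ABC:A2.D), seat
abc-iut-D3-typ (team D3 typer/anchor, gen 3), written AFTER the batch-2 and batch-3 blind lifts (D-ref-2 2026-08-26T09:16:57Z, D-ref-3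
09:33:12Z). It imports two teams' LANDED files BY NAME and restates nothing: team D3's typing `Thm311Charitable_3` (p431029) through
abc-iut-D3-prv's X-elimination `D3DeriveIff.thm311Charitable_3_iff` (p434033), and team D4's typing `Thm311Charitable_4` (p433089) through
abc-iut-D4-prv's `D4Derive.pilotKummerCompat_of_charitable_4` (p433392) and abc-iut-D4-typ's `D4.nfLinkCompat_of_partI_partII` (p433449).
The D3 ↔ D1/D2 legs are abc-iut-D3-prv's companion file `Thm311D3Concordance.lean`; D1 ↔ D2 is `Thm311D1D2Concordance.lean` (p429595).

WHAT IS PROVED (over ONE frozen `S : Thm311.LatticeSituation T`, a `Cor312.Setting` `P`, any region operator `ρ`, any q-datum `qK`).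
Team D4 packages the q-pilot's Kummer data as a binder `Q : D4.LinkKummerData S` (`Q.qΨ n m` for every theater) and its deriver reads the
pins' `qK` as `Q.qΨ P.n m`; team D3 hides its data `X : D3.Data S` under an `∃` and interprets `qK` by the clause `D3.QDatum`. Modulo that
packaging difference the two maximal readings carry THE SAME load:
* `charitable_4_load_iff` — given frozen (i) `S.PartI` and (ii) `S.PartII`: `(∃ Q, Thm311Charitable_4 S Q ∧ ∀ m, Q.qΨ P.n m = qK) ↔
  Cor312Vol.PilotKummerCompat S P qK` (abc-iut-w5-d068's datum-level clause p420303). «→» is D4-prv's extraction; «←» BUILDS the D4 data from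
  the clause: `qΨ := qK` on line `P.n`, the coric `Ψ` on every other line, unit-portion automorphism set `{1}`, strip automorphism set `∅` —
  (i) `MultiradialCompat` + (ii)(b) `KummerB` make D4's decisive clause `LinkKummerCompat` hold on every line (`exists_charitable_4_of_pilotKummerCompat`).
* `charitable_3_iff_hull_and_charitable_4_load` — `Thm311Charitable_3 S P ρ qK ↔ PilotKummerCompatHull S P ρ qK ∧ ∃ Q, Thm311Charitable_4 S Q ∧
  ∀ m, Q.qΨ P.n m = qK`: team D3's maximal reading = team D4's maximal reading read at the pins' datum ∧ the HULL conjunct `D3.IPLHull` that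
  team D3 (alone) placed inside its maximal conjunction; under the Θ-pin the hull conjunct is automatic (`…_of_thetaPinned`, `…_of_pinned3`).
* `charitable_3_of_charitable_4` / `charitable_4_load_of_charitable_3` — the two directions separately.
* `charitable_3H_iff_hull_and_literal_4` / `exists_literal_4_iff` — the weak variants: D4's LITERAL reading carries exactly frozen (i) ∧ (ii);
  D3's delimiter-respecting `Thm311Charitable_3H` = D4's literal reading ∧ the hull conjunct.
So, in kernel: the located gap's status is the same under either team's charity; the two typings differ by packaging and by one
S-idle hull conjunct, not by load. Whether the common load-bearing clause is FAITHFUL to print is the D referees' (c), untouched here.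

Source: S. Mochizuki, *Inter-universal Teichmüller theory III*, kurims manuscript (May 2020), Thm 3.11 pp. 153–159, Rmk 3.11.1
pp. 159–167 [claim: Mochizuki2012, status: disputed]. Framing: locates / conditionally verifies; NO abc claim; no side taken on Cor. 3.12,
on any author, or on either team's reading; typed ≠ proved; derived-under-a-reading ≠ endorsed.
-/

noncomputable section

open Set

namespace Summit.ABC.IUTFork.Charitable.D3D4Concordance

open Thm311 Cor312 Cor312Vol Literature.IUT.LogThetaLattice

variable {T : ThetaIndex} (S : LatticeSituation T) (P : Cor312.Setting S.toSituation)
  (ρ : (∀ v : T.V, v ∈ T.Vbad → Set (S.L.StarPacket v)) → ∀ (j : T.Label) (vQ : T.VQ), Set (S.L.Packet j vQ))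
  (qK : ∀ v : T.V, v ∈ T.Vbad → Set (S.L.StarPacket v))

/-! ## 1. Building team D4's link/Kummer data from the datum-level clause -/

/-- **(i) ∧ (ii) ∧ `PilotKummerCompat` ⊢ SOME D4 data satisfies team D4's maximal reading and has q-image `qK` at the Setting's column.**
The data (built inside the proof, no definition): the q-pilot Kummer image is `qK` on line `P.n` and the vertically coric splitting
monoid `Ψ` of (i)(b) on every other line (every `m`); the packet automorphisms induced by the unit-portion full poly-isomorphism of each
horizontal arrow are recorded as `{1}`, those induced by strip automorphisms as `∅` (the letter-only clauses `D4.LinkUnitCompat` /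
`D4.StripEquivariant` ask no more). The decisive clause `D4.LinkKummerCompat` holds on line `P.n` because `PilotKummerCompat` is the same
square read at the previous column (abc-iut-w5-d068 `pilotKummerCompat_iff_prevColumn`), and on every other line because the line-`n`
data IS a possible image `(S.D (n−1)).map Φ`, `Φ ∈ ⟨(Ind1) ∪ (Ind2)⟩`, of the line-`(n−1)` data (abc-iut-L6-t13 `MRData.mem_RLGP_iff`) whose
splitting monoid is the Kummer image `frobΨ 0` by (ii)(b); `D4.QKummerCoric` holds by construction and `D4.NFLinkCompat` is
abc-iut-D4-typ's `D4.nfLinkCompat_of_partI_partII`. [claim: Mochizuki2012, status: disputed] -/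
theorem exists_charitable_4_of_pilotKummerCompat (hI : S.PartI) (hII : S.PartII) (hK : PilotKummerCompat S P qK) :
    ∃ Q : D4.LinkKummerData S, Summit.ABC.IUTFork.Charitable.Thm311Charitable_4 S Q ∧ ∀ m : ℤ, Q.qΨ P.n m = qK := by
  have hMR : S.MultiradialCompat := hI.2.2
  have hB : ∀ n : ℤ, (S.col n).KummerB (S.D n) := fun n => (hII n).2.1
  refine ⟨⟨fun n _ => if n = P.n then qK else (S.D n).Ψ, fun _ _ => {1}, fun _ _ => ∅⟩,
    ⟨hI, hII, fun n m m' v hv => rfl, ⟨fun n m => ⟨Set.singleton_nonempty 1, Set.singleton_subset_iff.2 (one_mem _)⟩,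
      fun n m => Set.empty_subset _, D4.nfLinkCompat_of_partI_partII hI hII⟩, fun n m => ?_⟩, fun m => if_pos rfl⟩
  by_cases hn : n = P.n
  · subst hn
    obtain ⟨Φ₀, hΦ₀, m₀, h⟩ := (pilotKummerCompat_iff_prevColumn S P qK hMR (hB P.n) (hB (P.n - 1))).1 hK
    refine ⟨Φ₀, hΦ₀, m₀, fun v hv => ?_⟩
    show (if P.n = P.n then qK else (S.D P.n).Ψ) v hv = _
    rw [if_pos rfl]
    exact h v hv
  · obtain ⟨Φ, hΦ, hmap⟩ := (MRData.mem_RLGP_iff _ _).1 (S.mem_RLGP_of_multiradialCompat hMR (n - 1) n)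
    refine ⟨Φ, hΦ, 0, fun v hv => ?_⟩
    show (if n = P.n then qK else (S.D n).Ψ) v hv = _
    rw [if_neg hn, hmap, hB (n - 1) 0 v hv]
    rfl

/-! ## 2. The load of team D4's reading at the pins' datum ⟺ `PilotKummerCompat` (modulo frozen (i) ∧ (ii)) -/

/-- **D4 ⟹ the clause**: if SOME D4 data satisfying `Thm311Charitable_4` has q-pilot Kummer image `qK` on line `P.n`, then
`PilotKummerCompat S P qK` (abc-iut-D4-prv `D4Derive.pilotKummerCompat_of_charitable_4`, by name). [claim: Mochizuki2012, status: disputed] -/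
theorem pilotKummerCompat_of_charitable_4_load
    (h : ∃ Q : D4.LinkKummerData S, Summit.ABC.IUTFork.Charitable.Thm311Charitable_4 S Q ∧ ∀ m : ℤ, Q.qΨ P.n m = qK) :
    PilotKummerCompat S P qK := by
  obtain ⟨Q, hQ, hq⟩ := h
  rw [← hq 0]
  exact D4Derive.pilotKummerCompat_of_charitable_4 S Q P 0 hQ

/-- **`charitable_4_load_iff`** — given frozen (i) ∧ (ii): «some D4-charitable data has q-image `qK` at the Setting's column» ⟺
`PilotKummerCompat S P qK`. Team D4's maximal reading, read at the pins' datum, carries EXACTLY abc-iut-w5-d068's datum-level clause.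
[claim: Mochizuki2012, status: disputed] -/
theorem charitable_4_load_iff (hI : S.PartI) (hII : S.PartII) :
    (∃ Q : D4.LinkKummerData S, Summit.ABC.IUTFork.Charitable.Thm311Charitable_4 S Q ∧ ∀ m : ℤ, Q.qΨ P.n m = qK) ↔
      Summit.ABC.IUTFork.Cor312Vol.PilotKummerCompat S P qK :=
  ⟨pilotKummerCompat_of_charitable_4_load S P qK,
    exists_charitable_4_of_pilotKummerCompat S P qK hI hII⟩

/-! ## 3. D3 ↔ D4 -/

/-- **D4 ⟹ D3** at the pins' datum, given the hull conjunct team D3 carries: `Thm311Charitable_4 S Q` and `PilotKummerCompatHull` at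
`Q.qΨ P.n m` give `Thm311Charitable_3 S P ρ (Q.qΨ P.n m)` (abc-iut-D3-prv `D3DeriveIff.charitable_3_of_core`). [claim: Mochizuki2012, status: disputed] -/
theorem charitable_3_of_charitable_4 (Q : D4.LinkKummerData S) (h : Summit.ABC.IUTFork.Charitable.Thm311Charitable_4 S Q) (m : ℤ)
    (hH : PilotKummerCompatHull S P ρ (Q.qΨ P.n m)) :
    Summit.ABC.IUTFork.Charitable.Thm311Charitable_3 S P ρ (Q.qΨ P.n m) :=
  D3DeriveIff.charitable_3_of_core S P ρ (Q.qΨ P.n m) h.1 h.2.1 hH (D4Derive.pilotKummerCompat_of_charitable_4 S Q P m h)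

/-- **D4 ⟹ D3 under the Θ-pin** (no hull hypothesis: under (pΘ) the hull conjunct follows from `PilotKummerCompat`,
abc-iut-D3-prv `thm311Charitable_3_iff_of_thetaPinned`). [claim: Mochizuki2012, status: disputed] -/
theorem charitable_3_of_charitable_4_of_thetaPinned (hΘ : ThetaPinned S P ρ) (Q : D4.LinkKummerData S)
    (h : Summit.ABC.IUTFork.Charitable.Thm311Charitable_4 S Q) (m : ℤ) :
    Summit.ABC.IUTFork.Charitable.Thm311Charitable_3 S P ρ (Q.qΨ P.n m) :=
  (D3DeriveIff.thm311Charitable_3_iff_of_thetaPinned S P ρ (Q.qΨ P.n m) hΘ).2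
    ⟨h.1, h.2.1, D4Derive.pilotKummerCompat_of_charitable_4 S Q P m h⟩

/-- **D3 ⟹ D4**: team D3's maximal reading at `qK` yields D4-charitable data with q-image `qK` at the Setting's column (frozen (i) ∧ (ii)
and `PilotKummerCompat` extracted by `D3DeriveIff.thm311Charitable_3_iff`, then §1). [claim: Mochizuki2012, status: disputed] -/
theorem charitable_4_load_of_charitable_3 (h : Summit.ABC.IUTFork.Charitable.Thm311Charitable_3 S P ρ qK) :
    ∃ Q : D4.LinkKummerData S, Summit.ABC.IUTFork.Charitable.Thm311Charitable_4 S Q ∧ ∀ m : ℤ, Q.qΨ P.n m = qK := by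
  obtain ⟨hI, hII, -, hK⟩ := (D3DeriveIff.thm311Charitable_3_iff S P ρ qK).1 h
  exact (charitable_4_load_iff S P qK hI hII).2 hK

/-- **HEADLINE — `Thm311Charitable_3` = hull conjunct ∧ the load of `Thm311Charitable_4` at the pins' datum.** For every `S, P, ρ, qK`:
`Thm311Charitable_3 S P ρ qK ↔ PilotKummerCompatHull S P ρ qK ∧ ∃ Q, Thm311Charitable_4 S Q ∧ ∀ m, Q.qΨ P.n m = qK`. The two blind maximal
re-typings differ by team D3's S-idle hull conjunct (`D3.IPLHull`, (APT) p. 162 / (xi-d) p. 183) and by packaging, not by load.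
[claim: Mochizuki2012, status: disputed] -/
theorem charitable_3_iff_hull_and_charitable_4_load :
    Summit.ABC.IUTFork.Charitable.Thm311Charitable_3 S P ρ qK ↔
      Summit.ABC.IUTFork.Cor312Vol.PilotKummerCompatHull S P ρ qK ∧
        ∃ Q : D4.LinkKummerData S, Summit.ABC.IUTFork.Charitable.Thm311Charitable_4 S Q ∧ ∀ m : ℤ, Q.qΨ P.n m = qK := by
  constructor
  · intro h
    exact ⟨((D3DeriveIff.thm311Charitable_3_iff S P ρ qK).1 h).2.2.1, charitable_4_load_of_charitable_3 S P ρ qK h⟩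
  · rintro ⟨hH, Q, hQ, hq⟩
    rw [← hq 0] at hH ⊢
    exact charitable_3_of_charitable_4 S P ρ Q hQ 0 hH

/-- **Under the Θ-pin (pΘ) the two maximal readings are EQUIVALENT at the pins' datum** (hull conjunct automatic).
[claim: Mochizuki2012, status: disputed] -/
theorem charitable_3_iff_charitable_4_load_of_thetaPinned (hΘ : ThetaPinned S P ρ) :
    Summit.ABC.IUTFork.Charitable.Thm311Charitable_3 S P ρ qK ↔
      ∃ Q : D4.LinkKummerData S, Summit.ABC.IUTFork.Charitable.Thm311Charitable_4 S Q ∧ ∀ m : ℤ, Q.qΨ P.n m = qK := by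
  constructor
  · exact charitable_4_load_of_charitable_3 S P ρ qK
  · rintro ⟨Q, hQ, hq⟩
    rw [← hq 0]
    exact charitable_3_of_charitable_4_of_thetaPinned S P ρ hΘ Q hQ 0

/-- The same under all three pins `PinnedRegions3` (the arity of the block's question (a)). [claim: Mochizuki2012, status: disputed] -/
theorem charitable_3_iff_charitable_4_load_of_pinned3 (hpin : PinnedRegions3 S P ρ qK) :
    Summit.ABC.IUTFork.Charitable.Thm311Charitable_3 S P ρ qK ↔
      ∃ Q : D4.LinkKummerData S, Summit.ABC.IUTFork.Charitable.Thm311Charitable_4 S Q ∧ ∀ m : ℤ, Q.qΨ P.n m = qK :=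
  charitable_3_iff_charitable_4_load_of_thetaPinned S P ρ qK hpin.1.1

/-- **The delimiter-respecting D3 reading vs D4**: `Thm311Charitable_3H S P ρ qK ∧ (∃ Q, Thm311Charitable_4 S Q ∧ ∀ m, Q.qΨ P.n m = qK) ↔
Thm311Charitable_3 S P ρ qK` — adding team D4's load to team D3's hull-level reading gives back team D3's maximal reading (abc-iut-D3-prv
`thm311Charitable_3_iff_3H_and_pilotKummerCompat`). [claim: Mochizuki2012, status: disputed] -/
theorem charitable_3H_and_charitable_4_load_iff :
    (Summit.ABC.IUTFork.Charitable.Thm311Charitable_3H S P ρ qK ∧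
        ∃ Q : D4.LinkKummerData S, Summit.ABC.IUTFork.Charitable.Thm311Charitable_4 S Q ∧ ∀ m : ℤ, Q.qΨ P.n m = qK) ↔
      Summit.ABC.IUTFork.Charitable.Thm311Charitable_3 S P ρ qK := by
  rw [D3DeriveIff.thm311Charitable_3_iff_3H_and_pilotKummerCompat S P ρ qK]
  constructor
  · rintro ⟨hH, hQ⟩
    exact ⟨hH, pilotKummerCompat_of_charitable_4_load S P qK hQ⟩
  · rintro ⟨hH, hK⟩
    obtain ⟨hI, hII, -⟩ := (D3DeriveIff.thm311Charitable_3H_iff S P ρ qK).1 hH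
    exact ⟨hH, (charitable_4_load_iff S P qK hI hII).2 hK⟩

/-! ## 4. The weak variants: D3's delimiter-respecting reading = D4's literal reading ∧ the hull conjunct -/

/-- **Team D4's LITERAL reading carries exactly the frozen (i) ∧ (ii)**: some D4 data satisfies `D4.Thm311Literal_4` iff `S.PartI ∧ S.PartII`
(the letter-only (iii) clauses hold for unit-portion automorphism set `{1}`, strip automorphism set `∅`, and (iii)(d) is abc-iut-D4-typ's
theorem `D4.nfLinkCompat_of_partI_partII`; cf. team D1's `D1.thm311Literal_1_iff`). [claim: Mochizuki2012, status: disputed] -/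
theorem exists_literal_4_iff :
    (∃ Q : D4.LinkKummerData S, D4.Thm311Literal_4 S Q) ↔ S.PartI ∧ S.PartII := by
  constructor
  · rintro ⟨Q, hI, hII, -⟩
    exact ⟨hI, hII⟩
  · rintro ⟨hI, hII⟩
    exact ⟨⟨fun n _ => (S.D n).Ψ, fun _ _ => {1}, fun _ _ => ∅⟩, hI, hII,
      ⟨fun n m => ⟨Set.singleton_nonempty 1, Set.singleton_subset_iff.2 (one_mem _)⟩, fun n m => Set.empty_subset _,
        D4.nfLinkCompat_of_partI_partII hI hII⟩⟩

/-- **`Thm311Charitable_3H` = hull conjunct ∧ D4's literal reading**: team D3's delimiter-respecting variant is STRONGER than team D4's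
literal variant by exactly the (APT)/(xi-d) hull clause `D3.IPLHull` (abc-iut-D3-prv `D3DeriveIff.thm311Charitable_3H_iff`) — which is why
3H reaches the typed Corollary inequality under the q-pin (`D3Derive.statement_of_charitable_3H`) while `Thm311Literal_4` does not
(abc-iut-D4-cx `D4Countermodel.literal_4_and_pins_not_imp_statement`). [claim: Mochizuki2012, status: disputed] -/
theorem charitable_3H_iff_hull_and_literal_4 :
    Summit.ABC.IUTFork.Charitable.Thm311Charitable_3H S P ρ qK ↔
      Summit.ABC.IUTFork.Cor312Vol.PilotKummerCompatHull S P ρ qK ∧ ∃ Q : D4.LinkKummerData S, D4.Thm311Literal_4 S Q := by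
  rw [D3DeriveIff.thm311Charitable_3H_iff S P ρ qK, exists_literal_4_iff S]
  constructor
  · rintro ⟨hI, hII, hH⟩
    exact ⟨hH, hI, hII⟩
  · rintro ⟨hH, hI, hII⟩
    exact ⟨hI, hII, hH⟩

end Summit.ABC.IUTFork.Charitable.D3D4Concordance

end
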